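import Summits.PneNP.PneNP.Theorems.KarlinRubinMonotoneSufficesRoomBase

/-!
# Crux `MonotoneSuffices` (stmt-PneNP-18026), the GREEDY general detector — part 10b: parameters (integer side, final)

The final parameters of the greedy detector use the sixth power of the logarithm (so that every error exponent
dominates the crude bound `2^{O(log² n)}` on the number of trials without fine bookkeeping): with
`k = ⌈n^{1/2-δ}⌉`, `L = ⌊log₂ n⌋`, `Q = n (L+1)⁶/k² + 1`, `t = ⌊log₂ Q⌋ + 1` (so `n (L+1)⁶ < 2^t k² ≤ 4 n (L+1)⁶`),
`M = 4n/k + 1`, `θ = n/2^t + k/4 + 1`. This file: `eventually_kBig6` (`640 (L+1)⁶ ≤ k`) and the integer facts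
`natFacts6`. (Part 10a, `…GreedyParamsA`, has the fourth-power variants and the log-slack lemma.) Elementary.
-/

set_option linter.dupNamespace false -- `Summit.PneNP.PneNP.…`: summit = sub-problem name (D-0017 single-conjunct layout)

namespace Summit.PneNP.PneNP.Theorems.MonotoneSuffices.Greedy

open Filter Real Finset Asymptotics
open Summit.PneNP.PneNP.Theorems.MonotoneSuffices.Room

/-! ### Eventual base inequalities -/

/-- **Eventually `640 (L+1)⁶ ≤ k`**: `log⁶ n = o(n^{1/2-δ})`. [folklore] -/
theorem eventually_kBig6 {δ : ℝ} (hδ' : δ < 1 / 2) :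
    ∀ᶠ n : ℕ in atTop, 640 * (Nat.log 2 n + 1) ^ 6 ≤ ⌈(n : ℝ) ^ (1 / 2 - δ)⌉₊ := by
  have hr : (0 : ℝ) < (1 / 2 - δ) / 6 := by linarith
  -- `|log x| ≤ (log 2 / 12) x^{(1/2-δ)/6}` eventually
  have h1 : ∀ᶠ x : ℝ in atTop, ‖Real.log x‖ ≤ Real.log 2 / 12 * ‖x ^ ((1 / 2 - δ) / 6)‖ :=
    (isLittleO_log_rpow_atTop hr).bound (by positivity)
  have h1' := h1.natCast_atTop
  filter_upwards [h1', eventually_ge_atTop 2] with n hlog hn2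
  have hn1 : 1 ≤ n := by omega
  have hnpos : (0 : ℝ) < n := by exact_mod_cast (show 0 < n by omega)
  have hl2 : 0 < Real.log 2 := Real.log_pos one_lt_two
  -- `L + 1 ≤ 2 log₂ n = 2 log n / log 2`
  have hL : ((Nat.log 2 n : ℕ) : ℝ) + 1 ≤ 2 * (Real.log n / Real.log 2) := by
    have h : (Nat.log 2 n : ℝ) ≤ Real.logb 2 n := by
      rw [Real.le_logb_iff_rpow_le (by norm_num) hnpos, Real.rpow_natCast]
      exact_mod_cast Nat.pow_log_le_self 2 (by omega)
    have h1 := one_le_logb hn2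
    rw [Real.logb] at h h1
    linarith
  have hlog' : Real.log n ≤ Real.log 2 / 12 * (n : ℝ) ^ ((1 / 2 - δ) / 6) := by
    have := hlog
    rwa [Real.norm_of_nonneg (Real.log_nonneg (by exact_mod_cast hn1)),
      Real.norm_of_nonneg (Real.rpow_nonneg hnpos.le _)] at this
  have hpow6 : ((n : ℝ) ^ ((1 / 2 - δ) / 6)) ^ 6 = (n : ℝ) ^ (1 / 2 - δ) := by
    rw [← Real.rpow_mul_natCast hnpos.le]
    ring_nf
  -- `(L+1) ≤ 2 log n / log 2 ≤ x^{(1/2-δ)/6} / 6`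
  have hL' : ((Nat.log 2 n : ℕ) : ℝ) + 1 ≤ (n : ℝ) ^ ((1 / 2 - δ) / 6) / 6 := by
    have hdiv : Real.log n / Real.log 2 ≤ (n : ℝ) ^ ((1 / 2 - δ) / 6) / 12 := by
      rw [div_le_iff₀ hl2]
      linarith
    linarith
  have hL0 : 0 ≤ ((Nat.log 2 n : ℕ) : ℝ) + 1 := by positivity
  have hL6 : (((Nat.log 2 n : ℕ) : ℝ) + 1) ^ 6 ≤ (n : ℝ) ^ (1 / 2 - δ) / 46656 := by
    calc (((Nat.log 2 n : ℕ) : ℝ) + 1) ^ 6 ≤ ((n : ℝ) ^ ((1 / 2 - δ) / 6) / 6) ^ 6 := pow_le_pow_left₀ hL0 hL' 6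
      _ = (n : ℝ) ^ (1 / 2 - δ) / 46656 := by rw [div_pow, hpow6]; norm_num
  have h : ((640 * (Nat.log 2 n + 1) ^ 6 : ℕ) : ℝ) ≤ (⌈(n : ℝ) ^ (1 / 2 - δ)⌉₊ : ℝ) := by
    push_cast
    have := rpow_le_k δ n
    nlinarith [Real.rpow_nonneg hnpos.le (1 / 2 - δ)]
  exact_mod_cast h

/-! ### Integer bookkeeping for `Q`, `t`, `M`, `k` -/

/-- **The integer facts of the greedy detector.** [folklore] -/
theorem natFacts6 {n k L Q t M : ℕ} (hL : L = Nat.log 2 n) (hQ : Q = n * (L + 1) ^ 6 / k ^ 2 + 1)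
    (ht : t = Nat.log 2 Q + 1) (hM : M = 4 * n / k + 1) (hn : 2048 ≤ n) (hkBig : 640 * (L + 1) ^ 6 ≤ k)
    (h6k : 6 * k ≤ n) (hk2 : k ^ 2 ≤ 4 * n) :
    Q < 2 ^ t ∧ 2 ^ t ≤ 2 * Q ∧ Q * k ^ 2 ≤ n * (L + 1) ^ 6 + k ^ 2 ∧ n * (L + 1) ^ 6 < Q * k ^ 2 ∧
      1 ≤ t ∧ t ≤ 7 * L + 23 ∧ 160 * t ≤ k ∧ 4 * n < k * M ∧ M ≤ n ∧ 2 * (t * M) + 2 * k ≤ n ∧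
      2 ^ t * k ≤ 4 * n ∧ 2 ^ L ≤ n ∧ n < 2 ^ (L + 1) ∧ 11 ≤ L ∧ 80 * t + 64 ≤ (L + 1) ^ 6 ∧
      32 * (t * M) ≤ n ∧ 16 * (t * M + k) * k ≤ n * (L + 1) ^ 6 := by
  have hn0 : n ≠ 0 := by omega
  have hL1 : 1 ≤ (L + 1) ^ 6 := Nat.one_le_pow _ _ (by omega)
  have hk0 : 0 < k := by
    have : 640 ≤ 640 * (L + 1) ^ 6 := Nat.le_mul_of_pos_right _ (by positivity)
    omega
  have hk20 : 0 < k ^ 2 := by positivity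
  have hQ0 : Q ≠ 0 := by rw [hQ]; exact Nat.succ_ne_zero _
  -- `Q < 2^t ≤ 2Q`
  have h1 : Q < 2 ^ t := by rw [ht]; exact Nat.lt_pow_succ_log_self (by norm_num) Q
  have h2 : 2 ^ t ≤ 2 * Q := by
    rw [ht, pow_succ]
    have := Nat.pow_log_le_self 2 hQ0
    omega
  have h3 : Q * k ^ 2 ≤ n * (L + 1) ^ 6 + k ^ 2 := by
    rw [hQ, add_mul, one_mul]
    exact Nat.add_le_add_right (Nat.div_mul_le_self _ _) _
  have h4 : n * (L + 1) ^ 6 < Q * k ^ 2 := by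
    rw [hQ, add_mul, one_mul]
    exact Nat.lt_div_mul_add hk20
  -- `2^L ≤ n < 2^{L+1}`, `11 ≤ L`
  have hLn : 2 ^ L ≤ n := by rw [hL]; exact Nat.pow_log_le_self 2 hn0
  have hnL : n < 2 ^ (L + 1) := by rw [hL]; exact Nat.lt_pow_succ_log_self (by norm_num) n
  have hL11 : 11 ≤ L := by
    rw [hL]
    exact Nat.le_log_of_pow_le (by norm_num) (by norm_num; omega)
  -- `1 ≤ t ≤ 7L + 23`
  have h5 : 1 ≤ t := by rw [ht]; omega
  have h6 : t ≤ 7 * L + 23 := by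
    have hL1' : L + 1 ≤ 2 ^ L := Nat.lt_two_pow_self
    have hL4 : (L + 1) ^ 6 ≤ n ^ 6 := Nat.pow_le_pow_left (hL1'.trans hLn) 6
    have hQ' : Q ≤ n * (L + 1) ^ 6 + 1 := by rw [hQ]; exact Nat.add_le_add_right (Nat.div_le_self _ _) _
    have hn5 : 1 ≤ n ^ 7 := Nat.one_le_pow _ _ (Nat.pos_of_ne_zero hn0)
    have hE : n ^ 7 ≤ (2 ^ (L + 1)) ^ 7 := Nat.pow_le_pow_left hnL.le 7
    have hlt : 2 ^ t < 2 ^ (7 * L + 24) := by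
      calc 2 ^ t ≤ 2 * Q := h2
        _ ≤ 2 * (n * (L + 1) ^ 6 + 1) := Nat.mul_le_mul_left 2 hQ'
        _ ≤ 2 * (n * n ^ 6 + 1) := by
            have := Nat.mul_le_mul_left n hL4; omega
        _ = 2 * n ^ 7 + 2 := by ring
        _ < 2 ^ 17 * n ^ 7 := by omega
        _ ≤ 2 ^ 17 * (2 ^ (L + 1)) ^ 7 := Nat.mul_le_mul_left _ hE
        _ = 2 ^ (7 * L + 24) := by rw [← pow_mul, ← pow_add]; ring_nf
    have := (Nat.pow_lt_pow_iff_right (by norm_num)).1 hlt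
    omega
  -- `160 t ≤ k`, `80 t + 64 ≤ (L+1)^6`
  have hL6lin : 248832 * (L + 1) ≤ (L + 1) ^ 6 := by
    have h12 : 12 ≤ L + 1 := by omega
    calc 248832 * (L + 1) = 12 ^ 5 * (L + 1) := by norm_num
      _ ≤ (L + 1) ^ 5 * (L + 1) := Nat.mul_le_mul_right _ (Nat.pow_le_pow_left h12 5)
      _ = (L + 1) ^ 6 := by ring
  have h15 : 80 * t + 64 ≤ (L + 1) ^ 6 := by omega
  have h7 : 160 * t ≤ k := by
    have : 160 * (7 * L + 23) ≤ 640 * (L + 1) ^ 6 := by omega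
    omega
  -- `4n < kM`, `M ≤ n`
  have h8 : 4 * n < k * M := by
    rw [hM, mul_add, mul_one, mul_comm k (4 * n / k)]
    exact Nat.lt_div_mul_add hk0
  have h9 : M ≤ n := by
    rw [hM]
    have hk8 : 8 ≤ k := le_trans (by omega) h7
    have : 4 * n / k ≤ 4 * n / 8 := Nat.div_le_div_left hk8 (by norm_num)
    omega
  -- `2 tM + 2k ≤ n`: `tM ≤ t (4n/k + 1)`, and `k t (4n/k+1) ≤ 4 t n + t k`
  have h10 : 2 * (t * M) + 2 * k ≤ n := by
    have hMk : M * k ≤ 4 * n + k := by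
      rw [hM, add_mul, one_mul]
      exact Nat.add_le_add_right (Nat.div_mul_le_self _ _) _
    -- multiply the goal by `k`
    refine Nat.le_of_mul_le_mul_right ?_ hk0
    have hA : (2 * (t * M) + 2 * k) * k = 2 * t * (M * k) + 2 * k * k := by ring
    rw [hA]
    have hB : 2 * t * (M * k) ≤ 2 * t * (4 * n + k) := Nat.mul_le_mul_left _ hMk
    have hk2' : k * k ≤ 4 * n := by rw [← sq]; exact hk2
    -- `8 t n + 2 t k + 8 n ≤ n k` since `k ≥ 160 t ≥ 16 t + 16` ... use `k ≥ 160 t` and `t ≥ 1`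
    have hC : 2 * t * (4 * n + k) + 2 * k * k ≤ n * k := by
      have e1 : 160 * t * n ≤ k * n := Nat.mul_le_mul_right n h7
      have e2 : 160 * t * k ≤ 4 * n := (Nat.mul_le_mul_right k h7).trans hk2'
      have e4 : 9 * n ≤ k * n := Nat.mul_le_mul_right n (le_trans (by omega) h7)
      nlinarith [e1, e2, hk2', e4]
    calc 2 * t * (M * k) + 2 * k * k ≤ 2 * t * (4 * n + k) + 2 * k * k := by omega
      _ ≤ n * k := hC
  -- `2^t k ≤ 4n`: `2^t k² ≤ 2 (n (L+1)^4 + k²)` and `k ≥ (L+1)^4`, `2k ≤ n`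
  have h11 : 2 ^ t * k ≤ 4 * n := by
    refine Nat.le_of_mul_le_mul_right ?_ hk0
    have hA : 2 ^ t * k * k = 2 ^ t * k ^ 2 := by ring
    rw [hA]
    have hLk : (L + 1) ^ 6 ≤ k := le_trans (Nat.le_mul_of_pos_left _ (by norm_num)) hkBig
    calc 2 ^ t * k ^ 2 ≤ 2 * Q * k ^ 2 := Nat.mul_le_mul_right _ h2
      _ = 2 * (Q * k ^ 2) := by ring
      _ ≤ 2 * (n * (L + 1) ^ 6 + k ^ 2) := Nat.mul_le_mul_left _ h3
      _ ≤ 2 * (n * k + k ^ 2) := by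
          have := Nat.mul_le_mul_left n hLk; omega
      _ ≤ 4 * n * k := by
          have hkn : k ≤ n := by omega
          have e : k ^ 2 ≤ n * k := by rw [sq]; exact Nat.mul_le_mul_right k hkn
          nlinarith [e]
  -- `32 tM ≤ n`: multiply by `k`, `M k ≤ 4n + k`, `k ≥ 160 t`
  have hMk : M * k ≤ 4 * n + k := by
    rw [hM, add_mul, one_mul]
    exact Nat.add_le_add_right (Nat.div_mul_le_self _ _) _
  have h16 : 32 * (t * M) ≤ n := by
    refine Nat.le_of_mul_le_mul_right ?_ hk0
    have hA : 32 * (t * M) * k = 32 * t * (M * k) := by ring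
    rw [hA]
    have e1 : 160 * t * n ≤ k * n := Nat.mul_le_mul_right n h7
    have e2 : 160 * t * k ≤ k * n := (Nat.mul_le_mul_right k h7).trans (Nat.mul_le_mul_left k (by omega))
    calc 32 * t * (M * k) ≤ 32 * t * (4 * n + k) := Nat.mul_le_mul_left _ hMk
      _ ≤ n * k := by nlinarith [e1, e2]
  -- `16 (tM + k) k ≤ n (L+1)^6`
  have h17 : 16 * (t * M + k) * k ≤ n * (L + 1) ^ 6 := by
    have e1 : 16 * (t * M + k) * k = 16 * t * (M * k) + 16 * (k * k) := by ring
    rw [e1]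
    have hk2' : k * k ≤ 4 * n := by rw [← sq]; exact hk2
    have e2 : 16 * t * (M * k) ≤ 16 * t * (4 * n + k) := Nat.mul_le_mul_left _ hMk
    have e3 : 160 * t * k ≤ 4 * n := (Nat.mul_le_mul_right k h7).trans hk2'
    -- `64 t n + 16 t k + 64 n ≤ (80 t + 64) n ≤ (L+1)^6 n`
    have f1 : 16 * (t * k) ≤ n := by
      have e3' : 160 * (t * k) ≤ 4 * n := by simpa [Nat.mul_assoc] using e3
      omega
    have f2 : 16 * (k * k) ≤ 64 * n := by omega
    have f3 : 16 * t * (M * k) ≤ 64 * (t * n) + 16 * (t * k) := by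
      calc 16 * t * (M * k) ≤ 16 * t * (4 * n + k) := e2
        _ = 64 * (t * n) + 16 * (t * k) := by ring
    have f5 : 80 * (t * n) + 64 * n ≤ n * (L + 1) ^ 6 := by
      have e4 : (80 * t + 64) * n ≤ (L + 1) ^ 6 * n := Nat.mul_le_mul_right n h15
      have e5 : (80 * t + 64) * n = 80 * (t * n) + 64 * n := by ring
      have e6 : (L + 1) ^ 6 * n = n * (L + 1) ^ 6 := by ring
      rw [e5, e6] at e4
      exact e4
    have f6 : n ≤ t * n := Nat.le_mul_of_pos_left n (by omega)
    omega
  exact ⟨h1, h2, h3, h4, h5, h6, h7, h8, h9, h10, h11, hLn, hnL, hL11, h15, h16, h17⟩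

end Summit.PneNP.PneNP.Theorems.MonotoneSuffices.Greedy

namespace Summit.PneNP.PneNP.Theorems.MonotoneSuffices.Greedy

/-- Registered sub-goal `greedy_paramsN` of stmt-PneNP-18026 (greedy detector, part 10b): eventually
`640 (L+1)⁶ ≤ k`, exported verbatim. [folklore] -/
theorem greedy_paramsN :
    ∀ {δ : ℝ}, δ < 1 / 2 → ∀ᶠ n : ℕ in Filter.atTop, 640 * (Nat.log 2 n + 1) ^ 6 ≤ ⌈(n : ℝ) ^ (1 / 2 - δ)⌉₊ :=
  fun hδ' => eventually_kBig6 hδ'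

end Summit.PneNP.PneNP.Theorems.MonotoneSuffices.Greedy
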